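import Literature.NumberTheory.EllipticCurves.ZpExtensionEisensteinTwistFixedPointBoundProofs
import Literature.NumberTheory.GaloisRepresentations.LocalGlobalCohomology
import HarnessLib

/-!
# The local invariants of Howard's Eisenstein levels are killed by `[T]^{m-1}` for `m > 2p^s` (exponent form of the
# Cayley–Hamilton bound; theorems only)

`Proofs` file (theorems only; no definition, no named fact, no instance, no `sorry`).  Topic `NumberTheory/EllipticCurves`
(cell `pub/bsd-print-x9`; companion of x9-p1-w4's `ZpExtensionEisensteinTwistFixedPointBoundProofs`, which bounds the NUMBER
of twisted eigenvectors of one Galois element `σ₀` (`κ(σ₀) = N ≥ 1`, `m > 2N`) on `W_{m,j} = E[p^j] ⊗ A_{m,j}(ψ)` through the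
Cayley–Hamilton annihilator `Δ = 1 + a₁(1+T)^N + a₀(1+T)^{2N}`).  Here the EXPONENT form needed by Howard's hypothesis
H.5(b) at the places of `S` (x9-p1-w3's `ZpExtensionEisensteinSelmerH5bBadPlacesProofs`, hypothesis (SB)): for `N = p^s`,

* §1 `(1+T)^{p^s} − 1 − T^{p^s} ∈ pΛ` (binomial coefficients), hence in `A_{m,j}` (where `p = −T^m`)
  `(1+T)^{p^s} − 1 = [T]^{p^s} · (1 + [T]c)` for `m > p^s` (`onePlusT_pow_prime_pow_sub_one_eq`);
* §2 **`exists_charTwistElement_eq_mk_X_pow_mul`** — for `a₀ ∈ ℤ_p^×` and `m > 2p^s` the annihilator is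
  `Δ = [T]^a · ε` with `a ≤ 2p^s` and `ε` a unit of `A_{m,j}` (`a = 0`, `p^s` or `2p^s` according as `1 + a₁ + a₀`,
  `a₁ + 2a₀` are `p`-adic units); so `[T]^{m-1} ∈ (Δ)`;
* §3 **`ZpExtension.mk_X_pow_pred_smul_eq_zero_of_apply_eq_self`** — every `w ∈ W_{m,j}` fixed by `σ₀` (`κ(σ₀) = p^s`,
  `2p^s < m`) satisfies `[T]^{m-1} • w = 0`, for EVERY `j` (Cayley–Hamilton on `T_p E`, as in x9-p1-w4's file);
* §4 **`ZpExtension.mk_X_pow_pred_smul_eq_zero_of_forall_toLocal`** — hence the `Γ_{K_w}`-invariants of every level are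
  killed by `[T]^{m-1}` as soon as `κ(Γ_{K_w}) ∋ p^s` with `2p^s < m`: the hypothesis (SB) of H.5(b) at `w ∈ S`.

References: [Howard2004HeegnerKolyvagin] §1.3 H.4/H.5, §2.2, proof of Thm. 2.2.10; [GreenbergLNM1716] proof of Prop. 4.15;
[Washington1997] §7.1, §13.2 (Lemma 13.7); [SilvermanAEC2009] III.7.1. BSD is not proved by any of this.
-/

noncomputable section

open Polynomial Field

universe u

namespace Literature.NumberTheory.EllipticCurves

namespace IwasawaAlgebra

variable (p : ℕ) [hp : Fact p.Prime]

/-! ## §1 `(1+T)^{p^s} − 1 − T^{p^s} ∈ pΛ`, and its image in `A_{m,j}` -/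

/-- `(1+T)^{p^s} − 1 − T^{p^s} ∈ pΛ` (the middle binomial coefficients of a prime power are divisible by `p`).
[cite: Washington1997, §13.2 (Lemma 13.7, binomial expansion of (1+T)^{p^n})] -/
theorem one_add_X_pow_prime_pow_sub_mem_span_C (s : ℕ) :
    ((1 : IwasawaAlgebra p) + PowerSeries.X) ^ (p ^ s) - 1 - PowerSeries.X ^ (p ^ s) ∈
      Ideal.span {PowerSeries.C (p : ℤ_[p])} := by
  -- the polynomial `(X+1)^{p^s} - 1 - X^{p^s}` is divisible by `C p`
  have hdvd : Polynomial.C (p : ℤ_[p]) ∣ ((Polynomial.X + 1) ^ (p ^ s) - 1 - Polynomial.X ^ (p ^ s) : ℤ_[p][X]) := by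
    rw [Polynomial.C_dvd_iff_dvd_coeff]
    intro n
    rw [Polynomial.coeff_sub, Polynomial.coeff_sub, Polynomial.coeff_X_add_one_pow, Polynomial.coeff_one,
      Polynomial.coeff_X_pow]
    by_cases hn0 : n = 0
    · subst hn0
      rw [Nat.choose_zero_right, if_pos rfl, if_neg (pow_ne_zero s hp.out.ne_zero).symm]
      simp
    by_cases hns : n = p ^ s
    · subst hns
      rw [Nat.choose_self, if_neg hn0, if_pos rfl]
      simp
    · rw [if_neg hn0, if_neg hns, sub_zero, sub_zero]
      by_cases hlt : n < p ^ s
      · exact_mod_cast (Nat.cast_dvd_cast (hp.out.dvd_choose_pow hn0 hns) : ((p : ℕ) : ℤ_[p]) ∣ ((p ^ s).choose n : ℕ))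
      · rw [Nat.choose_eq_zero_of_lt (lt_of_le_of_ne (not_lt.mp hlt) (Ne.symm hns)), Nat.cast_zero]
        exact dvd_zero _
  obtain ⟨R, hR⟩ := hdvd
  rw [Ideal.mem_span_singleton]
  refine ⟨(R : PowerSeries ℤ_[p]), ?_⟩
  have h := congrArg (fun q : ℤ_[p][X] ↦ (q : PowerSeries ℤ_[p])) hR
  simp only [Polynomial.coe_sub, Polynomial.coe_pow, Polynomial.coe_add, Polynomial.coe_X, Polynomial.coe_one,
    Polynomial.coe_mul, Polynomial.coe_C] at h
  rw [add_comm] at h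
  exact h

namespace EisensteinCoeff

/-- `[C p] = −[T]^m` in `A_{m,k}`. [cite: Howard2004HeegnerKolyvagin, proof of Thm. 2.2.10 (𝔮 = T^m + p)] -/
theorem mk_C_eq_neg_mk_X_pow (m k : ℕ) :
    (Ideal.Quotient.mk _ (PowerSeries.C (p : ℤ_[p])) : EisensteinCoeff p m k) =
      -(Ideal.Quotient.mk _ PowerSeries.X) ^ m := by
  rw [eq_neg_iff_add_eq_zero, add_comm, ← map_pow, ← map_add, Ideal.Quotient.eq_zero_iff_mem]
  exact Ideal.mem_sup_left (Ideal.mem_span_singleton_self _)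

/-- A unit plus `[T]`-multiple is a unit in `A_{m,k}` (`[T]` is nilpotent). [cite: Washington1997, §7.1] -/
theorem isUnit_add_mk_X_mul {m k : ℕ} {υ : EisensteinCoeff p m k} (hυ : IsUnit υ) (z : EisensteinCoeff p m k) :
    IsUnit (υ + Ideal.Quotient.mk _ PowerSeries.X * z) := by
  obtain ⟨w, rfl⟩ := hυ
  have hXz : IsNilpotent ((Ideal.Quotient.mk _ PowerSeries.X : EisensteinCoeff p m k) * z) :=
    Commute.isNilpotent_mul_right (Commute.all _ _) (isNilpotent_mk_X p m k)
  have hnil : IsNilpotent (((w⁻¹ : (EisensteinCoeff p m k)ˣ) : EisensteinCoeff p m k) *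
      ((Ideal.Quotient.mk _ PowerSeries.X : EisensteinCoeff p m k) * z)) :=
    Commute.isNilpotent_mul_left (Commute.all _ _) hXz
  have h1 : (w : EisensteinCoeff p m k) + Ideal.Quotient.mk _ PowerSeries.X * z =
      (w : EisensteinCoeff p m k) * (1 + ((w⁻¹ : (EisensteinCoeff p m k)ˣ) : EisensteinCoeff p m k) *
        ((Ideal.Quotient.mk _ PowerSeries.X : EisensteinCoeff p m k) * z)) := by
    rw [mul_add, mul_one, ← mul_assoc, Units.mul_inv, one_mul]
  rw [h1]
  exact (Units.isUnit w).mul hnil.isUnit_one_add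

/-- **`(1+T)^{p^s} − 1 = [T]^{p^s}(1 + [T]c)` in `A_{m,k}` for `m > p^s`** (`p = −T^m`). [cite: Washington1997, §13.2 (Lemma 13.7)]
[cite: Howard2004HeegnerKolyvagin, proof of Thm. 2.2.10] -/
theorem onePlusT_pow_prime_pow_sub_one_eq {m : ℕ} (k s : ℕ) (hms : p ^ s < m) :
    ∃ c : EisensteinCoeff p m k, onePlusT p m k ^ (p ^ s) - 1 =
      (Ideal.Quotient.mk _ PowerSeries.X) ^ (p ^ s) * (1 + Ideal.Quotient.mk _ PowerSeries.X * c) := by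
  obtain ⟨R, hR⟩ := Ideal.mem_span_singleton'.mp (one_add_X_pow_prime_pow_sub_mem_span_C p s)
  obtain ⟨d, rfl⟩ := Nat.exists_eq_add_of_lt hms
  refine ⟨-((Ideal.Quotient.mk _ PowerSeries.X) ^ d * Ideal.Quotient.mk _ R), ?_⟩
  have h1 : onePlusT p (p ^ s + d + 1) k ^ (p ^ s) - 1 -
      (Ideal.Quotient.mk _ PowerSeries.X : EisensteinCoeff p (p ^ s + d + 1) k) ^ (p ^ s) =
      Ideal.Quotient.mk _ R * Ideal.Quotient.mk _ (PowerSeries.C (p : ℤ_[p])) := by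
    rw [onePlusT_def, ← map_pow, ← map_one (Ideal.Quotient.mk _), ← map_sub, ← map_pow, ← map_sub, ← hR, map_mul]
  have hXm : (Ideal.Quotient.mk _ PowerSeries.X : EisensteinCoeff p (p ^ s + d + 1) k) ^ (p ^ s + d + 1) =
      (Ideal.Quotient.mk _ PowerSeries.X) ^ (p ^ s) * (Ideal.Quotient.mk _ PowerSeries.X *
        (Ideal.Quotient.mk _ PowerSeries.X) ^ d) := by ring
  rw [mk_C_eq_neg_mk_X_pow, hXm] at h1
  linear_combination h1

/-! ## §2 The annihilator `Δ = 1 + a₁(1+T)^{p^s} + a₀(1+T)^{2p^s}` is `[T]^a · unit`, `a ≤ 2p^s`, for `m > 2p^s` -/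

/-- `ℤ_p → A_{m,k}` sends `z` to the class of the constant `C z`. [cite: Howard2004HeegnerKolyvagin, §2.2 (A_𝔮/p^k)] -/
theorem algebraMap_padicInt_eq_mk_C (m k : ℕ) (z : ℤ_[p]) :
    algebraMap ℤ_[p] (EisensteinCoeff p m k) z = Ideal.Quotient.mk _ (PowerSeries.C z) := by
  rw [← Ideal.Quotient.mk_algebraMap, PowerSeries.algebraMap_eq]

/-- A non-unit of `ℤ_p` is `p` times something. [cite: Washington1997, §7.1] -/
theorem exists_eq_p_mul_of_not_isUnit {x : ℤ_[p]} (hx : ¬IsUnit x) : ∃ y : ℤ_[p], x = (p : ℤ_[p]) * y := by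
  have hmem : x ∈ IsLocalRing.maximalIdeal ℤ_[p] := hx
  rw [PadicInt.maximalIdeal_eq_span_p, Ideal.mem_span_singleton'] at hmem
  obtain ⟨y, rfl⟩ := hmem
  exact ⟨y, mul_comm _ _⟩

/-- **The Cayley–Hamilton annihilator is `[T]^a · unit` with `a ≤ 2p^s`** (`a₀` a unit, `m > 2p^s`): writing
`u = (1+T)^{p^s} = 1 + D`, `D = [T]^{p^s}ε₀`, `Δ = (1 + a₁ + a₀) + (a₁ + 2a₀)D + a₀D²`, and `p = −[T]^m` with `m > 2p^s`.
[cite: Howard2004HeegnerKolyvagin, §2.2 and proof of Thm. 2.2.10] [cite: GreenbergLNM1716, proof of Prop. 4.15] -/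
theorem exists_charTwistElement_eq_mk_X_pow_mul {m : ℕ} (k s : ℕ) (a₁ a₀ : ℤ_[p]) (ha₀ : IsUnit a₀)
    (hms : 2 * p ^ s < m) :
    ∃ (a : ℕ) (ε : EisensteinCoeff p m k), a ≤ 2 * p ^ s ∧ IsUnit ε ∧
      1 + algebraMap ℤ_[p] (EisensteinCoeff p m k) a₁ * onePlusT p m k ^ (p ^ s) +
          algebraMap ℤ_[p] (EisensteinCoeff p m k) a₀ * (onePlusT p m k ^ (p ^ s)) ^ 2 =
        (Ideal.Quotient.mk _ PowerSeries.X) ^ a * ε := by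
  -- `m = 2ν + e + 1`, `ν = p^s ≥ 1`
  obtain ⟨e, rfl⟩ := Nat.exists_eq_add_of_lt hms
  have hν1 : 1 ≤ p ^ s := Nat.one_le_pow _ _ hp.out.pos
  obtain ⟨c, hc⟩ := onePlusT_pow_prime_pow_sub_one_eq p (m := 2 * p ^ s + e + 1) k s (by omega)
  -- notation
  let A := EisensteinCoeff p (2 * p ^ s + e + 1) k
  let X₁ : A := Ideal.Quotient.mk _ PowerSeries.X
  let ε₀ : A := 1 + X₁ * c
  have hε₀u : IsUnit ε₀ := isUnit_add_mk_X_mul p isUnit_one c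
  have huD : onePlusT p (2 * p ^ s + e + 1) k ^ (p ^ s) = 1 + X₁ ^ (p ^ s) * ε₀ := by
    rw [← hc, add_sub_cancel]
  -- the expansion in `D = u - 1 = X₁^ν ε₀`
  have hΔ : 1 + algebraMap ℤ_[p] A a₁ * onePlusT p (2 * p ^ s + e + 1) k ^ (p ^ s) +
      algebraMap ℤ_[p] A a₀ * (onePlusT p (2 * p ^ s + e + 1) k ^ (p ^ s)) ^ 2 =
      algebraMap ℤ_[p] A (1 + a₁ + a₀) + algebraMap ℤ_[p] A (a₁ + 2 * a₀) * (X₁ ^ (p ^ s) * ε₀) +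
        algebraMap ℤ_[p] A a₀ * (X₁ ^ (p ^ s) * ε₀) ^ 2 := by
    rw [huD, map_add, map_add, map_one, map_add, map_mul, map_ofNat]; ring
  -- `p = -X₁^m = -X₁^ν X₁^ν (X₁ X₁^e)`
  have hp' : ∀ y : ℤ_[p], algebraMap ℤ_[p] A ((p : ℤ_[p]) * y) =
      -(X₁ ^ (p ^ s) * X₁ ^ (p ^ s) * (X₁ * X₁ ^ e)) * algebraMap ℤ_[p] A y := by
    intro y
    rw [map_mul, algebraMap_padicInt_eq_mk_C p _ k (p : ℤ_[p]), mk_C_eq_neg_mk_X_pow]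
    ring
  -- `X₁^ν = X₁ * X₁^(ν-1)`
  have hXν : X₁ ^ (p ^ s) = X₁ * X₁ ^ (p ^ s - 1) := by
    rw [← pow_succ', Nat.sub_add_cancel hν1]
  by_cases hF : IsUnit (1 + a₁ + a₀)
  · -- `a = 0`: `Δ` is a unit
    refine ⟨0, algebraMap ℤ_[p] A (1 + a₁ + a₀) + X₁ * (X₁ ^ (p ^ s - 1) * (algebraMap ℤ_[p] A (a₁ + 2 * a₀) * ε₀ +
          algebraMap ℤ_[p] A a₀ * X₁ ^ (p ^ s) * ε₀ ^ 2)), Nat.zero_le _, isUnit_add_mk_X_mul p (hF.map _) _, ?_⟩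
    rw [pow_zero, one_mul, hΔ, hXν]
    ring
  · obtain ⟨f', hf'⟩ := exists_eq_p_mul_of_not_isUnit p hF
    by_cases hB : IsUnit (a₁ + 2 * a₀)
    · -- `a = ν`
      refine ⟨p ^ s, algebraMap ℤ_[p] A (a₁ + 2 * a₀) * ε₀ + X₁ * (algebraMap ℤ_[p] A a₀ * X₁ ^ (p ^ s - 1) * ε₀ ^ 2 -
          X₁ ^ (p ^ s) * X₁ ^ e * algebraMap ℤ_[p] A f'), by omega,
        isUnit_add_mk_X_mul p ((hB.map _).mul hε₀u) _, ?_⟩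
      rw [hΔ, hf', hp', hXν]
      ring
    · -- `a = 2ν`
      obtain ⟨b', hb'⟩ := exists_eq_p_mul_of_not_isUnit p hB
      refine ⟨2 * p ^ s, algebraMap ℤ_[p] A a₀ * ε₀ ^ 2 + X₁ * -(X₁ ^ e * (algebraMap ℤ_[p] A f' +
          algebraMap ℤ_[p] A b' * X₁ ^ (p ^ s) * ε₀)), le_rfl,
        isUnit_add_mk_X_mul p ((ha₀.map _).mul (hε₀u.pow 2)) _, ?_⟩
      rw [hΔ, hf', hb', hp', hp']
      ring

/-- Hence **`[T]^{m-1} ∈ (Δ)`**: `[T]^{m-1} = r · Δ` for some `r ∈ A_{m,k}` (`m > 2p^s`). [cite: Howard2004HeegnerKolyvagin, §2.2 and proof of Thm. 2.2.10] -/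
theorem exists_mk_X_pow_pred_eq_mul_charTwistElement {m : ℕ} (k s : ℕ) (a₁ a₀ : ℤ_[p]) (ha₀ : IsUnit a₀)
    (hms : 2 * p ^ s < m) :
    ∃ r : EisensteinCoeff p m k, (Ideal.Quotient.mk _ PowerSeries.X : EisensteinCoeff p m k) ^ (m - 1) =
      r * (1 + algebraMap ℤ_[p] (EisensteinCoeff p m k) a₁ * onePlusT p m k ^ (p ^ s) +
        algebraMap ℤ_[p] (EisensteinCoeff p m k) a₀ * (onePlusT p m k ^ (p ^ s)) ^ 2) := by
  obtain ⟨a, ε, ha, hε, hΔ⟩ := exists_charTwistElement_eq_mk_X_pow_mul p k s a₁ a₀ ha₀ hms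
  obtain ⟨w, rfl⟩ := hε
  refine ⟨(Ideal.Quotient.mk _ PowerSeries.X) ^ (m - 1 - a) * ((w⁻¹ : (EisensteinCoeff p m k)ˣ) : EisensteinCoeff p m k), ?_⟩
  rw [hΔ, mul_assoc, mul_left_comm (((w⁻¹ : (EisensteinCoeff p m k)ˣ) : EisensteinCoeff p m k)), Units.inv_mul,
    mul_one, ← pow_add, Nat.sub_add_cancel (by omega)]

end EisensteinCoeff

end IwasawaAlgebra

/-! ## §3 Fixed vectors of `σ₀` on `E[p^j] ⊗ A_{m,j}(ψ)` are killed by `[T]^{m-1}` -/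

namespace ZpExtension

open IwasawaAlgebra IwasawaAlgebra.EisensteinCoeff Literature.NumberTheory.GaloisRepresentations Literature.Algebra.Module

variable {K : Type u} [Field K] (W : WeierstrassCurve K) [W.IsElliptic] {p : ℕ} [hp : Fact p.Prime]
  (κ : ZpExtension K p) {m : ℕ} (hm : 1 ≤ m)

/-- **`[T]^{m-1}` kills the `σ₀`-fixed vectors of `E[p^j] ⊗ A_{m,j}(ψ)`** when `κ(σ₀) = p^s` and `2p^s < m`, for every `j`:
by Cayley–Hamilton on `T_p E` the fixed vectors are killed by `Δ = 1 + a₁u + a₀u²` (`u = (1+T)^{p^s}`, x9-p1-w4's count file),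
and `[T]^{m-1} ∈ (Δ)` (§2). [cite: Howard2004HeegnerKolyvagin, §1.3 H.5(b) and §2.2, proof of Thm. 2.2.10]
[cite: GreenbergLNM1716, proof of Prop. 4.15] [cite: SilvermanAEC2009, Prop. III.7.1] -/
theorem mk_X_pow_pred_smul_eq_zero_of_apply_eq_self (hpK : (p : K) ≠ 0) {σ₀ : absoluteGaloisGroup K} {s : ℕ}
    (hσ : (κ σ₀).toAdd = ((p ^ s : ℕ) : ℤ_[p])) (hms : 2 * p ^ s < m) (j : ℕ)
    (w : Twisted p m j (W.geomTorsion ((p : ℤ) ^ j)))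
    (hw : κ.eisensteinTwist (W.torsionGaloisModule ((p : ℤ) ^ j)) hm j σ₀ w = w) :
    ((Ideal.Quotient.mk _ PowerSeries.X : EisensteinCoeff p m j) ^ (m - 1)) • w = 0 := by
  rcases Nat.eq_zero_or_pos j with rfl | hj
  · -- `A_{m,0}` is the zero ring
    have h1 : (1 : EisensteinCoeff p m 0) = 0 := by
      rw [← map_one (Ideal.Quotient.mk _), Ideal.Quotient.eq_zero_iff_mem]
      refine Ideal.mem_sup_right ?_
      rw [pow_zero, map_one]
      exact Ideal.mem_span_singleton_self _
    rw [← one_smul (EisensteinCoeff p m 0) w, h1, zero_smul, smul_zero]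
  obtain ⟨a₁, a₀, ha₀, hCH⟩ := W.exists_cayleyHamilton_torsion p hpK σ₀
  -- abbreviations (as in `natCard_setOf_eisensteinTwist_apply_eq_smul_le`)
  set A := EisensteinCoeff p m j with hA
  set M := ↥(W.geomTorsion ((p : ℤ) ^ j)) with hM
  set ρ := W.torsionGaloisModule ((p : ℤ) ^ j) with hρ
  set u : A := onePlusT p m j ^ (p ^ s) with hu
  have hcast : ∀ a : ℤ_[p], algebraMap ℤ_[p] A a = ((PadicInt.toZModPow j a).val : A) := fun a ↦ by
    rw [EisensteinCoeff.algebraMap_padicInt_eq_ofZMod_toZModPow p hm j, EisensteinCoeff.ofZMod_apply]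
  -- the twisted action of `σ₀` as an `A`-linear endomorphism
  let φ : Module.End A (Twisted p m j M) :=
    { toFun := fun w ↦ κ.eisensteinTwist ρ hm j σ₀ w
      map_add' := fun x y ↦ map_add _ x y
      map_smul' := fun c x ↦ κ.eisensteinTwist_apply_smul ρ hm j σ₀ c x }
  have hφ : ∀ w, φ w = κ.eisensteinTwist ρ hm j σ₀ w := fun _ ↦ rfl
  have hφt : ∀ (c : A) (a : M), φ (Twisted.tmul c a) = Twisted.tmul (u * c) (σ₀ • a) := fun c a ↦ by
    rw [hφ, eisensteinTwist_apply_tmul, κ.onePlusT_pow_twistExponent_eq_of_toAdd_eq_natCast hm j hσ, hρ,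
      WeierstrassCurve.torsionGaloisModule_apply_apply]
  -- Cayley–Hamilton at level `j`, inside `E[p^j]`
  have hCHj : ∀ a : M, σ₀ • σ₀ • a + (PadicInt.toZModPow j a₁).val • σ₀ • a + (PadicInt.toZModPow j a₀).val • a = 0 :=
    fun a ↦ by
    have ha : ((p : ℤ) ^ j) • (a : W.geomPoints) = 0 := (Submodule.mem_torsionBy_iff _ _).1 a.2
    have h := hCH j (a : W.geomPoints) ha
    apply Subtype.ext
    rw [natCast_zsmul, natCast_zsmul] at h
    have e : ((σ₀ • σ₀ • a + (PadicInt.toZModPow j a₁).val • σ₀ • a + (PadicInt.toZModPow j a₀).val • a : M) :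
        W.geomPoints) = σ₀ • σ₀ • (a : W.geomPoints) + (PadicInt.toZModPow j a₁).val • σ₀ • (a : W.geomPoints) +
          (PadicInt.toZModPow j a₀).val • (a : W.geomPoints) := rfl
    rw [e, h]
    rfl
  -- the homogenised characteristic polynomial kills `φ`
  set b₁ : A := algebraMap ℤ_[p] A a₁ * u with hb₁
  set b₀ : A := algebraMap ℤ_[p] A a₀ * u ^ 2 with hb₀
  set P : A[X] := X ^ 2 + C b₁ * X + C b₀ with hPdef
  have hP : aeval φ P = 0 := by
    refine LinearMap.ext fun w ↦ ?_
    induction w using Twisted.induction_on with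
    | zero => rw [map_zero, LinearMap.zero_apply]
    | add x y hx hy => rw [map_add, hx, hy, LinearMap.zero_apply, LinearMap.zero_apply, LinearMap.zero_apply, add_zero]
    | tmul c a =>
      rw [LinearMap.zero_apply, hPdef]
      simp only [map_add, map_mul, aeval_X, aeval_C, LinearMap.add_apply, Module.End.mul_apply,
        Module.algebraMap_end_apply, pow_two]
      have e1 : b₁ * (u * c) = ((PadicInt.toZModPow j a₁).val : A) * (u * (u * c)) := by rw [hb₁, hcast]; ring
      have e2 : b₀ * c = ((PadicInt.toZModPow j a₀).val : A) * (u * (u * c)) := by rw [hb₀, hcast]; ring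
      rw [hφt, hφt, Twisted.smul_tmul, Twisted.smul_tmul, e1, e2, ← nsmul_eq_mul, ← nsmul_eq_mul,
        Twisted.nsmul_tmul, Twisted.nsmul_tmul, ← Twisted.tmul_add, ← Twisted.tmul_add, hCHj, Twisted.tmul_zero]
  -- `w` is a `1`-eigenvector of `φ`, hence killed by `P(1) = Δ`
  have hw1 : φ w = (1 : A) • w := by rw [one_smul]; exact hw
  have hkill : P.eval 1 • w = 0 := eval_smul_eq_zero_of_aeval_eq_zero hP hw1
  have hP1 : P.eval 1 = 1 + algebraMap ℤ_[p] A a₁ * u + algebraMap ℤ_[p] A a₀ * u ^ 2 := by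
    rw [hPdef]; simp only [eval_add, eval_mul, eval_pow, eval_X, eval_C, hb₁, hb₀]; ring
  obtain ⟨r, hr⟩ := EisensteinCoeff.exists_mk_X_pow_pred_eq_mul_charTwistElement p j s a₁ a₀ ha₀ hms
  rw [hr, ← hP1, mul_smul, hkill, smul_zero]

/-! ## §4 The local invariants at a place whose decomposition group meets `κ⁻¹(p^s)`, `2p^s < m` -/

variable {K : Type} [Field K] [NumberField K] (E : WeierstrassCurve K) [E.IsElliptic] (κ' : ZpExtension K p)

/-- **Hypothesis (SB) of H.5(b) at a finite place `w`.**  If some `g₀ ∈ Γ_{K_w}` has `κ(g₀) = p^s` with `2p^s < m`, then for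
every `j` every `Γ_{K_w}`-invariant vector of `E[p^j] ⊗ A_{m,j}(ψ)` is killed by `[T]^{m-1}`.
[cite: Howard2004HeegnerKolyvagin, §1.3 H.5(b) and §2.2] [cite: GreenbergLNM1716, proof of Prop. 4.15] -/
theorem mk_X_pow_pred_smul_eq_zero_of_forall_toLocal (w : IsDedekindDomain.HeightOneSpectrum (NumberField.RingOfIntegers K))
    {g₀ : absoluteGaloisGroup (w.adicCompletion K)} {s : ℕ}
    (hg₀ : (κ' (absGaloisRestrict K (w.adicCompletion K) g₀)).toAdd = ((p ^ s : ℕ) : ℤ_[p])) (hms : 2 * p ^ s < m)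
    (j : ℕ) (x : Twisted p m j (E.geomTorsion ((p : ℤ) ^ j)))
    (hx : ∀ g : absoluteGaloisGroup (w.adicCompletion K),
      ((κ'.eisensteinTwist (E.torsionGaloisModule ((p : ℤ) ^ j)) hm j).toLocal (Sum.inr w)) g x = x) :
    ((Ideal.Quotient.mk _ PowerSeries.X : EisensteinCoeff p m j) ^ (m - 1)) • x = 0 :=
  mk_X_pow_pred_smul_eq_zero_of_apply_eq_self E κ' hm (Nat.cast_ne_zero.2 hp.out.ne_zero) hg₀ hms j x (hx g₀)

end ZpExtension

end Literature.NumberTheory.EllipticCurves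

end
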